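import Literature.MathematicalPhysics.QuantumLattice.DWaveSourceKomaTasakiField
import Literature.MathematicalPhysics.QuantumLattice.PairFieldCommutatorLocality
import HarnessLib

/-!
# Koma–Tasaki for the summit's pair-field long-range order: `Re⟨Δ_d†Δ_d⟩ ≥ c·L⁴` in ground states
# ⟹ `dWaveOrderParameter U μ ≥ √c`

T. Koma, H. Tasaki, Commun. Math. Phys. **158** (1993) Theorem 7.3 (7.11) and J. Stat. Phys. **76** (1994)
§1, Theorem 2.5 (2.30), §3.3 (`KomaTasaki1993`, `KomaTasaki1994`): `m ≥ √2 σ` for a `U(1)` order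
parameter.  The companion file `DWaveSourceKomaTasakiField.lean` PROVES this for the `d`-wave pair field of
the two-dimensional Hubbard model with the long-range order measured by `σ_Λ² = Re Φ†(Δ_d+Δ_d†)²Φ / L⁴`
(`le_dWaveOrderParameter_of_pairLRO`: `(sL²)² ≤ Re Φ†(Δ_d+Δ_d†)²Φ` eventually ⟹ `m* ≥ s/√2`).  The summit
(`HasPairFieldLRO`) and the cell's certificates measure pair long-range order by `Re Φ†Δ_d†Δ_dΦ ≥ c·L⁴`
instead.  This file supplies the dictionary and the resulting statement:

* `dotProduct_pairField_sq_eq_zero_of_number_eigenvector`, `…_conjTranspose_sq_…` — the CHARGE SELECTION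
  RULES `Φ†Δ_d²Φ = 0 = Φ†(Δ_d†)²Φ` in a particle-number eigenvector (KT94 (2.16)/(2.18): `Δ_d = ½O⁻` lowers
  the charge `C = N/2` of the instance `dWaveKTSystem` by one; `dWaveKTSystem_orderMinus/Plus`:
  `O∓_sys = toEuclideanCLM (2Δ_d)`, `toEuclideanCLM (2Δ_d†)`);
* `dotProduct_order_sq_eq_of_number_eigenvector` — hence
  `Φ†(Δ_d+Δ_d†)²Φ = 2·Φ†Δ_d†Δ_dΦ + Φ†[Δ_d,Δ_d†]Φ`;
* **`le_dWaveOrderParameter_of_pairFieldLRO`** — with the tree's locality bound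
  `|Re Φ†[Δ_d,Δ_d†]Φ| ≤ C·L²` (`exists_abs_re_expect_commutator_pairField_le`, Bratteli–Robinson II §6.2.1):
  if eventually in `L` the torus `(ℤ/(L+1)ℤ)²` carries a normalised particle-number-eigenvector ground state
  of `H(1,U) - μN` with `c·(L+1)⁴ ≤ Re Φ†Δ_d†Δ_dΦ`, then `√c ≤ dWaveOrderParameter U μ` (every `s² < 2c` is
  an admissible `(Δ+Δ†)²`-level eventually, and `√2·s/2 ↑ √c`).  The Kaplan–Horsch–von der Linden engine
  of route `AbsenceCertificate` (`SourcedOrderDominatesLRO`) gives `√(c/2)`; this is the `√2`-sharp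
  Koma–Tasaki version.  Contrapositive (CQ-TABLE B2(b)): a certified `dWaveOrderParameter U μ ≤ m` excludes
  ground-state pair-field LRO at every level `c > m²`.

Conventions as in the companion files (`DecidableEq (FermionTorus 2 L) := LinearOrder.toDecidableEq` via
`attribute [local instance] instDecidableEqFermionTorusKT`).  Direction LRO ⟹ response only
(`Literature.Barriers.HubbardSuperconductivity.SourcedOrderWithoutGroundStateLRO`).
-/

noncomputable section

open Matrix Complex Finset WithLp Literature.Probability.LatticeModels
open Literature.Barriers.HubbardSuperconductivity
open scoped Matrix.Norms.L2Operator InnerProductSpace ComplexConjugate ComplexOrder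

namespace Literature.MathematicalPhysics.QuantumLattice

open KomaTasaki DWaveKT Filter
open scoped Topology

attribute [local instance 10000] instDecidableEqFermionTorusKT

/-! ### Charge selection rules and the `(Δ+Δ†)²` vs `Δ†Δ` dictionary -/

section PairFieldLRO

variable {L : ℕ} [NeZero L]

omit [NeZero L] in
/-- `⟨toLp x, toLp y⟩ = x† y`. [folklore] -/
private theorem inner_toLp_toLp_eq'' (x y : FockIdx L → ℂ) :
    ⟪(toLp 2 x : EuclideanSpace ℂ (FockIdx L)), toLp 2 y⟫_ℂ = star x ⬝ᵥ y := by
  rw [EuclideanSpace.inner_toLp_toLp, dotProduct_comm]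

omit [NeZero L] in
/-- `‖toLp v‖² = Re v†v`. [folklore] -/
private theorem norm_toLp_sq_eq' (v : FockIdx L → ℂ) :
    ‖(toLp 2 v : EuclideanSpace ℂ (FockIdx L))‖ ^ 2 = (star v ⬝ᵥ v).re := by
  rw [← inner_toLp_toLp_eq'', ← inner_self_eq_norm_sq (𝕜 := ℂ)]
  rfl

omit [NeZero L] in
/-- A unit Fock vector is a unit vector of `EuclideanSpace`. [folklore] -/
private theorem norm_toLp_eq_one {v : FockIdx L → ℂ} (hv : star v ⬝ᵥ v = 1) :
    ‖(toLp 2 v : EuclideanSpace ℂ (FockIdx L))‖ = 1 := by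
  have h2 : ‖(toLp 2 v : EuclideanSpace ℂ (FockIdx L))‖ ^ 2 = 1 := by
    rw [norm_toLp_sq_eq', hv, Complex.one_re]
  have h0 : 0 ≤ ‖(toLp 2 v : EuclideanSpace ℂ (FockIdx L))‖ := norm_nonneg _
  nlinarith

/-- `O⁻_sys = toEuclideanCLM (2Δ_g)` for the instance (`O⁻ = O^{(1)} - iO^{(2)} = (Δ+Δ†) + (Δ-Δ†)`).
[cite: KomaTasaki1994, (2.15), §3.3] -/
theorem dWaveKTSystem_orderMinus (t U μ : ℝ) (g : Site 2 → ℝ) (hg : 0 < pairNormConst g) :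
    (dWaveKTSystem L t U μ g hg).orderMinus =
      toEuclideanCLM (n := FockIdx L) (𝕜 := ℂ) ((2 : ℂ) • pairField g L) := by
  rw [KomaTasaki.U1OverlapSystem.orderMinus_eq, dWaveKTSystem_order_zero, dWaveKTSystem_order_one,
    ← map_smul, ← map_sub]
  congr 1
  rw [smul_smul, Complex.I_mul_I]
  module

/-- `O⁺_sys = toEuclideanCLM (2Δ_g†)`. [cite: KomaTasaki1994, (2.15), §3.3] -/
theorem dWaveKTSystem_orderPlus (t U μ : ℝ) (g : Site 2 → ℝ) (hg : 0 < pairNormConst g) :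
    (dWaveKTSystem L t U μ g hg).orderPlus =
      toEuclideanCLM (n := FockIdx L) (𝕜 := ℂ) ((2 : ℂ) • (pairField g L)ᴴ) := by
  rw [KomaTasaki.U1OverlapSystem.orderPlus_eq, dWaveKTSystem_order_zero, dWaveKTSystem_order_one,
    ← map_smul, ← map_add]
  congr 1
  rw [smul_smul, Complex.I_mul_I]
  module

/-- **Charge selection rule**: in a particle-number eigenvector, `⟨Φ, Δ_g² Φ⟩ = 0` (the vector `Δ_g²Φ`
has `N`-eigenvalue `ν - 4`).  Via the instance: `Δ_g = ½ O⁻` lowers the `U(1)` charge `C = N/2` by one.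
[cite: KomaTasaki1994, (2.16), (2.18)] -/
theorem dotProduct_pairField_sq_eq_zero_of_number_eigenvector (g : Site 2 → ℝ)
    (hg : 0 < pairNormConst g) {Φ : FockIdx L → ℂ} {ν : ℂ} (hN : totalNumber *ᵥ Φ = ν • Φ) :
    star Φ ⬝ᵥ (pairField g L *ᵥ (pairField g L *ᵥ Φ)) = 0 := by
  by_cases hΦ : Φ = 0
  · subst hΦ; simp
  set sys := dWaveKTSystem L 1 0 0 g hg with hsys
  have hC : sys.C (toLp 2 Φ) = ((2 : ℂ)⁻¹ * ν) • toLp 2 Φ := by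
    rw [hsys, dWaveKTSystem_C, toEuclideanCLM_toLp, smul_mulVec, hN, smul_smul, toLp_smul]
  have h2 := sys.collapse.C_orderMinus_pow_apply hC 2
  have hne : (toLp 2 Φ : EuclideanSpace ℂ (FockIdx L)) ≠ 0 := fun h => hΦ ((toLp_eq_zero 2).mp h)
  have hc := sys.collapse.conj_eq_of_eigen_C hne hC
  have hzero : ⟪(toLp 2 Φ : EuclideanSpace ℂ (FockIdx L)),
      (sys.collapse.orderMinus ^ 2) (toLp 2 Φ)⟫_ℂ = 0 := by
    refine sys.collapse.inner_eq_zero_of_eigen_C hC h2 ?_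
    rw [hc]
    intro h
    have := congrArg Complex.re h
    simp only [Complex.sub_re] at this
    norm_num at this
    linarith
  -- `(O^-)² toLp Φ = toLp ((2Δ)² Φ)`
  have hOm : sys.collapse.orderMinus =
      toEuclideanCLM (n := FockIdx L) (𝕜 := ℂ) ((2 : ℂ) • pairField g L) :=
    dWaveKTSystem_orderMinus 1 0 0 g hg
  rw [hOm, ← map_pow, toEuclideanCLM_toLp, inner_toLp_toLp_eq'', pow_two, Matrix.smul_mul,
    Matrix.mul_smul, smul_smul, smul_mulVec, dotProduct_smul, smul_eq_zero, ← mulVec_mulVec] at hzero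
  rcases hzero with h | h
  · norm_num at h
  · exact h

/-- **Charge selection rule, adjoint**: in a particle-number eigenvector, `⟨Φ, (Δ_g†)² Φ⟩ = 0`.
[cite: KomaTasaki1994, (2.16), (2.18)] -/
theorem dotProduct_pairField_conjTranspose_sq_eq_zero_of_number_eigenvector (g : Site 2 → ℝ)
    (hg : 0 < pairNormConst g) {Φ : FockIdx L → ℂ} {ν : ℂ} (hN : totalNumber *ᵥ Φ = ν • Φ) :
    star Φ ⬝ᵥ ((pairField g L)ᴴ *ᵥ ((pairField g L)ᴴ *ᵥ Φ)) = 0 := by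
  by_cases hΦ : Φ = 0
  · subst hΦ; simp
  set sys := dWaveKTSystem L 1 0 0 g hg with hsys
  have hC : sys.C (toLp 2 Φ) = ((2 : ℂ)⁻¹ * ν) • toLp 2 Φ := by
    rw [hsys, dWaveKTSystem_C, toEuclideanCLM_toLp, smul_mulVec, hN, smul_smul, toLp_smul]
  have h2 := sys.collapse.C_orderPlus_pow_apply hC 2
  have hne : (toLp 2 Φ : EuclideanSpace ℂ (FockIdx L)) ≠ 0 := fun h => hΦ ((toLp_eq_zero 2).mp h)
  have hc := sys.collapse.conj_eq_of_eigen_C hne hC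
  have hzero : ⟪(toLp 2 Φ : EuclideanSpace ℂ (FockIdx L)),
      (sys.collapse.orderPlus ^ 2) (toLp 2 Φ)⟫_ℂ = 0 := by
    refine sys.collapse.inner_eq_zero_of_eigen_C hC h2 ?_
    rw [hc]
    intro h
    have := congrArg Complex.re h
    simp only [Complex.add_re] at this
    norm_num at this
  have hOp : sys.collapse.orderPlus =
      toEuclideanCLM (n := FockIdx L) (𝕜 := ℂ) ((2 : ℂ) • (pairField g L)ᴴ) :=
    dWaveKTSystem_orderPlus 1 0 0 g hg
  rw [hOp, ← map_pow, toEuclideanCLM_toLp, inner_toLp_toLp_eq'', pow_two, Matrix.smul_mul,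
    Matrix.mul_smul, smul_smul, smul_mulVec, dotProduct_smul, smul_eq_zero, ← mulVec_mulVec] at hzero
  rcases hzero with h | h
  · norm_num at h
  · exact h

/-- In a particle-number eigenvector the `(Δ+Δ†)²`-long-range order is the symmetrised pair LRO:
`Φ†(Δ_g+Δ_g†)²Φ = Φ†(Δ_gΔ_g† + Δ_g†Δ_g)Φ = 2·Φ†Δ_g†Δ_gΦ + Φ†[Δ_g,Δ_g†]Φ`.
[cite: KomaTasaki1994, (2.17)–(2.18), §3.3] -/
theorem dotProduct_order_sq_eq_of_number_eigenvector (g : Site 2 → ℝ) (hg : 0 < pairNormConst g)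
    {Φ : FockIdx L → ℂ} {ν : ℂ} (hN : totalNumber *ᵥ Φ = ν • Φ) :
    star Φ ⬝ᵥ ((pairField g L + (pairField g L)ᴴ) *ᵥ ((pairField g L + (pairField g L)ᴴ) *ᵥ Φ)) =
      2 * (star Φ ⬝ᵥ ((pairField g L)ᴴ *ᵥ (pairField g L *ᵥ Φ))) +
        star Φ ⬝ᵥ ((pairField g L * (pairField g L)ᴴ - (pairField g L)ᴴ * pairField g L) *ᵥ Φ) := by
  have h1 := dotProduct_pairField_sq_eq_zero_of_number_eigenvector (L := L) g hg hN
  have h2 := dotProduct_pairField_conjTranspose_sq_eq_zero_of_number_eigenvector (L := L) g hg hN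
  simp only [add_mulVec, mulVec_add, sub_mulVec, ← mulVec_mulVec, dotProduct_add, dotProduct_sub]
  rw [h1, h2]
  ring


variable (U μ : ℝ)

/-- **Koma–Tasaki for the summit's pair-field long-range order.**  If, eventually in `L`, the
grand-canonical Hamiltonian `H(1,U) - μN` on `(ℤ/(L+1)ℤ)²` has a normalised particle-number-eigenvector
ground state `Φ` with PAIR-FIELD long-range order `c·(L+1)⁴ ≤ Re Φ†Δ_d†Δ_dΦ` (`c > 0`; the finite-volume
form of `HasPairFieldLRO`), then the Koma–Tasaki `d`-wave order parameter satisfies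
`dWaveOrderParameter U μ ≥ √c` — Koma–Tasaki's `m ≥ √2 σ` in the tree's normalisation
(`(Δ_d+Δ_d†)²`-order `= 2·Δ_d†Δ_d`-order up to the `O(L²)` commutator `[Δ_d,Δ_d†]`,
`exists_abs_re_expect_commutator_pairField_le`; the Kaplan–Horsch–von der Linden trial state gives only
`√(c/2)`, `Summit.HubbardSuperconductivity.…AbsenceCertificate.SourcedOrderDominatesLRO`).  Contrapositive:
a certified ceiling `dWaveOrderParameter U μ ≤ m` excludes ground-state pair-field LRO at every level
`c > m²`. [cite: KomaTasaki1993, Theorem 7.3 (7.11)] [cite: KomaTasaki1994, §1, Theorem 2.5 (2.30), §3.3] -/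
theorem le_dWaveOrderParameter_of_pairFieldLRO (c : ℝ) (hc : 0 < c)
    (hLRO : ∀ᶠ L : ℕ in atTop, ∃ (Φ : FockIdx (L + 1) → ℂ) (ν : ℂ), star Φ ⬝ᵥ Φ = 1 ∧
      (hubbardTorusWith 2 (L + 1) 1 U μ).IsGroundStateVector Φ ∧ totalNumber *ᵥ Φ = ν • Φ ∧
      c * ((L + 1 : ℕ) : ℝ) ^ 4 ≤
        (star Φ ⬝ᵥ ((pairField dWaveFormFactor (L + 1))ᴴ *ᵥ
          (pairField dWaveFormFactor (L + 1) *ᵥ Φ))).re) :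
    Real.sqrt c ≤ dWaveOrderParameter U μ := by
  set K : ℝ := pairNormConst dWaveFormFactor with hKdef
  have hK : 0 < K := pairNormConst_dWave_pos
  obtain ⟨C, L₁, hC0, hC⟩ := exists_abs_re_expect_commutator_pairField_le dWaveFormFactor
  -- (i) `c ≤ K²` (pair-field LRO cannot exceed `‖Δ_d‖²/L⁴ ≤ K²`)
  have hcK : c ≤ K ^ 2 := by
    obtain ⟨L, Φ, ν, hΦ1, -, -, hlro⟩ := hLRO.exists
    have hre : (star Φ ⬝ᵥ ((pairField dWaveFormFactor (L + 1))ᴴ *ᵥ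
        (pairField dWaveFormFactor (L + 1) *ᵥ Φ))).re =
        ‖(toLp 2 (pairField dWaveFormFactor (L + 1) *ᵥ Φ) : EuclideanSpace ℂ (FockIdx (L + 1)))‖ ^ 2 := by
      rw [norm_toLp_sq_eq', dotProduct_mulVec, ← star_mulVec]
    have hn1 : ‖(toLp 2 Φ : EuclideanSpace ℂ (FockIdx (L + 1)))‖ = 1 := norm_toLp_eq_one hΦ1
    have hbound : ‖(toLp 2 (pairField dWaveFormFactor (L + 1) *ᵥ Φ) :
        EuclideanSpace ℂ (FockIdx (L + 1)))‖ ≤ K * ((L + 1 : ℕ) : ℝ) ^ 2 := by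
      rw [← toEuclideanCLM_toLp]
      refine (ContinuousLinearMap.le_opNorm _ _).trans ?_
      rw [hn1, mul_one, Matrix.l2_opNorm_toEuclideanCLM]
      exact norm_pairField_le dWaveFormFactor (L + 1)
    have hpos : (0 : ℝ) < ((L + 1 : ℕ) : ℝ) ^ 4 := by positivity
    have h1 : c * ((L + 1 : ℕ) : ℝ) ^ 4 ≤ (K * ((L + 1 : ℕ) : ℝ) ^ 2) ^ 2 := by
      rw [hre] at hlro
      exact hlro.trans (pow_le_pow_left₀ (norm_nonneg _) hbound 2)
    have h2 : (K * ((L + 1 : ℕ) : ℝ) ^ 2) ^ 2 = K ^ 2 * ((L + 1 : ℕ) : ℝ) ^ 4 := by ring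
    rw [h2] at h1
    exact le_of_mul_le_mul_right h1 hpos
  -- (ii) every `s` with `s² < 2c` is an admissible `(Δ+Δ†)²`-order level, eventually
  have hstep : ∀ s : ℝ, 0 < s → s ^ 2 < 2 * c →
      Real.sqrt 2 * s / 2 ≤ dWaveOrderParameter U μ := by
    intro s hs hs2
    have hsK : s ≤ 2 * K := by nlinarith [hcK, hK]
    apply le_dWaveOrderParameter_of_pairLRO U μ s hs hsK
    have hgap : 0 < 2 * c - s ^ 2 := by linarith
    have hev : ∀ᶠ L : ℕ in atTop, C ≤ (2 * c - s ^ 2) * ((L + 1 : ℕ) : ℝ) ^ 2 := by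
      rw [eventually_atTop]
      refine ⟨⌈C / (2 * c - s ^ 2)⌉₊, fun L hL => ?_⟩
      have h1 : C / (2 * c - s ^ 2) ≤ L := (Nat.le_ceil _).trans (by exact_mod_cast hL)
      rw [div_le_iff₀ hgap] at h1
      have h2 : (L : ℝ) ≤ ((L + 1 : ℕ) : ℝ) ^ 2 := by
        have : (L : ℝ) ≤ ((L + 1 : ℕ) : ℝ) := by exact_mod_cast Nat.le_succ L
        have h1' : (1 : ℝ) ≤ ((L + 1 : ℕ) : ℝ) := by exact_mod_cast Nat.succ_le_succ (Nat.zero_le L)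
        nlinarith
      nlinarith
    filter_upwards [hLRO, hev, eventually_ge_atTop L₁] with L hL hCL hL1
    obtain ⟨Φ, ν, hΦ1, hgs, hN, hlro⟩ := hL
    refine ⟨Φ, ν, hΦ1, hgs, hN, ?_⟩
    have hsel := dotProduct_order_sq_eq_of_number_eigenvector (L := L + 1) dWaveFormFactor
      pairNormConst_dWave_pos hN
    have hcomm := hC (L + 1) (Nat.le_succ_of_le hL1) Φ hΦ1
    unfold expect at hcomm
    have hcomm' := (abs_le.mp hcomm).1
    rw [hsel, Complex.add_re]
    have hre2 : ((2 : ℂ) * (star Φ ⬝ᵥ ((pairField dWaveFormFactor (L + 1))ᴴ *ᵥ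
        (pairField dWaveFormFactor (L + 1) *ᵥ Φ)))).re =
        2 * (star Φ ⬝ᵥ ((pairField dWaveFormFactor (L + 1))ᴴ *ᵥ
          (pairField dWaveFormFactor (L + 1) *ᵥ Φ))).re := by
      simp [Complex.mul_re]
    rw [hre2]
    have e : (s * ((L + 1 : ℕ) : ℝ) ^ 2) ^ 2 = s ^ 2 * (((L + 1 : ℕ) : ℝ) ^ 2) ^ 2 := by ring
    rw [e]
    have h4 : ((L + 1 : ℕ) : ℝ) ^ 4 = (((L + 1 : ℕ) : ℝ) ^ 2) ^ 2 := by ring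
    rw [h4] at hlro
    have hsq : 0 ≤ ((L + 1 : ℕ) : ℝ) ^ 2 := by positivity
    nlinarith [mul_le_mul_of_nonneg_right hCL hsq]
  -- (iii) `√c ≤ m*` by density
  refine le_of_forall_lt_imp_le_of_dense fun a ha => ?_
  by_cases ha0 : a ≤ 0
  · exact ha0.trans (dWaveOrderParameter_nonneg U μ)
  push Not at ha0
  have ha2 : a ^ 2 < c := by
    have hsc := Real.sq_sqrt hc.le
    nlinarith [Real.sqrt_nonneg c, ha, ha0]
  have h := hstep (Real.sqrt 2 * a) (by positivity)
    (by rw [mul_pow, Real.sq_sqrt (by norm_num : (0 : ℝ) ≤ 2)]; linarith)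
  have e : Real.sqrt 2 * (Real.sqrt 2 * a) / 2 = a := by
    rw [← mul_assoc, Real.mul_self_sqrt (by norm_num : (0 : ℝ) ≤ 2)]; ring
  rwa [e] at h

end PairFieldLRO

end Literature.MathematicalPhysics.QuantumLattice
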